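import Summits.QuantumFields.YangMills.Theorems.AlphaInputsT3ACv3RegionalDataContinuity
import Summits.QuantumFields.YangMills.Theorems.AlphaInputsT3ACv3AdaptedClassX
import Summits.QuantumFields.YangMills.Theorems.UnitScaleTiltProp8EulerLagrangeCarrier
import HarnessLib

/-!
# `AlphaInputsT3ACv3Data7Closed` — B1 EDGES-A v2, FILE 1 (T³ half): (C1) THE JOINTLY (7)-REGULAR DATA SET `𝒟₇(k, h)` IS CLOSED, (C2) THE REGIONAL REGULAR
# FIBRE (8) READ WITH `≤` IS CLOSED ON THE LOCAL SMALL-LOOP CORE, (C3) THE NORMALISED DATUM MAP IS CONTINUOUS THERE, AND THE CONSTRAINT'S READ CONE IS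
# EXACTLY DEPENDENCY-CLOSED — the closed sets `A`, `C` that ✓ `FrozenSelection.exists_frozenSelector` and ✓ `exists_measurable_argmin_closedClass` take for B1

Cell `ym3-torus` (HUMAN RULING D-0037; YM ladder rung R3 = finite-torus SU(2) YM₃, NOT the Clay problem), width seat `ym-ust-19936-w2` (gen 6) on
stmt-QuantumFields-19936 `HistoryTailL`; LEAD ★w1-19936 g4 RULING L-R6 (2026-08-28T11:22Z); the B1 STATEMENT SPEC memo `B1-STATEMENT-SPEC-w2g6.md` (19936
evidence #47) §4 rows (C1)–(C3).  Generic half: ✓ `…v3RegionalDataContinuity`.  `--supports stmt-QuantumFields-19936 --as helper`; def-free; count-neutral.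

WHAT (T³, `SU(2)`, the lane's `ℰp`, the regions `Ω_j(h) = Carriers.Omega …`, `Λ_j(h) = lam42 Ω(h) k j` of a history `h : Hist (F.P K) k`):
* (C1) ★ `AlphaInputsT3AC.isClosed_data7` — the multi-level data `𝓥 : (j : ℕ) → GaugeField (F.P K) j SU(2)` with (D0) one-step `δ∕2`-small loops at the levels `< k`,
  (D1) print's (7) (`RegionalVP.Reg7On`'s text incl. the cross-boundary datum) READ WITH `≤` at level radii `ε₁`, (D2) recorded-large at `P_j(h)` (the ζ-clause) form a
  CLOSED set, for ANY `ε₁ : ℕ → ℝ` — LITERALLY the three conjuncts of LEAD FILE 2's `AlphaInputsT3AC.data7Set … k h ε₁` (draft v2 §1), so `IsClosed (data7Set …)` follows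
  by `unfold`; the conjunct sets are also closed separately (`isClosed_smallLoopData_T3`, `…_inter_reg7OnLe_T3`, `isClosed_recLargeData_T3`) and a (40)-cap conjunct
  `isClosed_cappedData_T3` (any `κ : ℕ → ℝ`) is provided for capped variants.
* (C2) ★ `AlphaInputsT3AC.isClosed_coreFibreRegLe` — for ANY exactly dependency-closed bond family `E ⊇` the read bonds of (3): `NestedSmallOn ℰp (δ∕2) E k ∩ {(2) with ≤
  over the Ω_j(h), BOTH clauses} ∩ {(3) ConstraintOn … 𝓥}` is CLOSED; the regularity clauses are closed outright (`isClosed_regOnT3Le`: plaquettes by ✓ `continuous_plaqHol`,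
  the covariant divergence at spacing `η = L^{−k}` by ✓ `Prop8Criticality.continuous_covDivT` + ✓ `covDivT_eq_smul` = `continuous_covDivT_eta`).
* (C3) ★ `AlphaInputsT3AC.continuousOn_datumE_T3`.
* The cone: `AlphaInputsT3AC.depClosed₂_constraintCone` — the exact dependency hull of `⋃_{i ≤ k} bondsOn i (Λ_i(h))`, written INLINE (def-free), is `DepClosed₂` (block saturation,
  ✓ `coarsen_eq_of_coarsen_eq` ∕ ✓ `coarsen_toFine`; pattern ✓ `depClosed₂_readBondsT3`); `AlphaInputsT3AC.bondsOn_subset_constraintCone`; the corollaries at the cone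
  `AlphaInputsT3AC.isClosed_coneFibreRegLe` ∕ `AlphaInputsT3AC.continuousOn_datumE_cone`.
HONEST FRAMING.  Topology∕bookkeeping only: no estimate of [Balaban1985UV3]∕[Balaban1985Variational] is asserted; B1, EDGES-B (Theorem 1 at the regional members),
NODE O, the stub `AlphaInputsT3ACv4RecChi`, the crux `HistoryTailL` are NOT claimed.  The `≤`-readings are the closures of print's strict (2)∕(7); scope (R-Ω-2) of memo
#47 S1 (`Ω₀ = univ` as in `Carriers.Omega`).  YM₃ on the three-torus is rung R3 of the programme, NOT the Clay problem: nothing here bears on d = 4, infinite volume,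
or a mass gap.

References: T. Bałaban, Commun. Math. Phys. 102 (1985) 277–309 [Balaban1985Variational] ((2)–(3), (7) p.278, Thm 1 (8) p.279); Commun. Math. Phys. 102 (1985)
255–275 [Balaban1985UV3] ((40)–(42) p.266, (67)–(68) p.273); Commun. Math. Phys. 99 (1985) 75–102 [Balaban1985RegularSpaces] ((1.1)–(1.2) p.76, (1.7), (1.9) p.77);
Commun. Math. Phys. 109 (1987) 249–301 [Balaban1987RG1] ((0.4) p.253); C. D. Aliprantis, K. C. Border, Infinite Dimensional Analysis, 3rd ed. (2006)
[AliprantisBorder2006] (Thm 18.19 p.605).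
-/

set_option autoImplicit false

noncomputable section

/-! ## §1 The T³ instance: (C1) the data set `𝒟₇` is closed, (C2) the regular fibre (8) with `≤` is closed on the core, (C3), and the constraint's cone -/

namespace Summit.QuantumFields.YangMills.Theorems

open MeasureTheory Set Topology
open scoped Matrix.Norms.L2Operator
open Literature.MathematicalPhysics.QuantumFieldTheory.Balaban1983to89
open Literature.MathematicalPhysics.QuantumFieldTheory.Balaban1983to89.T3ContinuumYM3Torus
open Literature.MathematicalPhysics.QuantumFieldTheory.Balaban1983to89.T3UnitLawDensityEML (ℰp)
open Literature.MathematicalPhysics.QuantumFieldTheory.Balaban1983to89.BlockAveraging (blockAvg loopHol Idx)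
open Literature.MathematicalPhysics.QuantumFieldTheory.Balaban1983to89.B10Eq38TorusDomains (plaqsIn toFine toFine_succ cornerSet)
open Literature.MathematicalPhysics.QuantumFieldTheory.Balaban1983to89.B10Eq42TorusConstraint (lam42)
open Literature.MathematicalPhysics.QuantumFieldTheory.Balaban1983to89.B10Eq27TorusAxialLog (toUField unitsField)
open Literature.MathematicalPhysics.QuantumFieldTheory.Balaban1983to89.B10Eq68TorusRegularity (Touches BTouches covDivT covDivT_eq_smul)
open Literature.MathematicalPhysics.QuantumFieldTheory.Balaban1985CMP102.Setting
open Summit.QuantumFields.Balaban3D.Carriers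
open Summit.QuantumFields.Balaban3D.Proofs.Primitives (AlphaConsts)
open Summit.QuantumFields.BalabanUV.T4Continuum.SubstrateBlockAvgContinuity (smallContinuous_expMeanLogSU SmallContinuous)
open Summit.QuantumFields.YangMills.Theorems.BalabanUVNodesN08AlphaGroupTopology (continuous_plaqHol)
open Summit.QuantumFields.YangMills.Theorems.LocalSmallLoop (NestedSmallOn Feeds₂ DepClosed₂ isClosed_nestedSmallOn₂)
open Summit.QuantumFields.YangMills.Theorems.RegionalVP
open Summit.QuantumFields.YangMills.Theorems.Prop8Criticality (continuous_covDivT)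

section T3

variable {F : T3Family} {𝔠 : AlphaConsts F.L (suGroupModel 2).N} {γ : ℝ} {hγ : 0 < γ} {hγ1 : γ ≤ (min 𝔠.gamma0 1) ^ 2} {K : ℕ}

/-- `δ∕2 < δ` for the lane's small-loop average `ℰp`. [folklore] -/
private theorem half_delta_lt : ℰp.δ / 2 < (ℰp : LoopAverage (Matrix.specialUnitaryGroup (Fin 2) ℂ)).δ := by
  linarith [ℰp.δ_pos]

/-- A set `{x | c → q x}` cut by a fixed proposition `c` is closed when `{x | q x}` is. [folklore] -/
private theorem isClosed_setOf_imp {α : Type*} [TopologicalSpace α] {c : Prop} {q : α → Prop} (h : IsClosed {x | q x}) :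
    IsClosed {x | c → q x} := by
  by_cases hc : c
  · have hset : {x : α | c → q x} = {x | q x} := Set.ext fun x => ⟨fun hx => hx hc, fun hx _ => hx⟩
    rw [hset]; exact h
  · have hset : {x : α | c → q x} = univ := eq_univ_of_forall fun x (h' : c) => absurd h' hc
    rw [hset]; exact isClosed_univ

/-- **(D0) IS CLOSED**: the one-step small-loop class of multi-level `SU(2)` data (margin `δ∕2`, levels `< k`). [cite: Balaban1987RG1, (0.4) p.253] -/
theorem AlphaInputsT3AC.isClosed_smallLoopData_T3 (k : ℕ) :
    IsClosed {𝓥 : (j : ℕ) → GaugeField (F.P K) j (Matrix.specialUnitaryGroup (Fin 2) ℂ) |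
      ∀ i, i < k → ∀ (c : PBond (F.P K) (i + 1)) (x : Idx (F.P K)), GaugeGroup.dist1 (loopHol (𝓥 i) c x) ≤ ℰp.δ / 2} :=
  isClosed_smallLoopData AlphaInputsT3AC.continuous_dist1_su2 k (ℰp.δ / 2)

/-- **(D0) ∧ (D1) IS CLOSED**: on the one-step small-loop class, print's (7) for the history `h` — the cross-boundary datum `datumAt (blockAvg ℰp) Λ(h) 𝓥 j` at
radius `ε₁ j`, read with `≤`, on the plaquettes touching `Λ_j(h)` and (below the top) avoiding `Ω_{j+1}(h)` — is a closed condition; any level radii `ε₁ : ℕ → ℝ`.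
[cite: Balaban1985Variational, (7) p.278] -/
theorem AlphaInputsT3AC.isClosed_smallLoopData_inter_reg7OnLe_T3 (k : ℕ) (h : Hist (F.P K) k) (ε₁ : ℕ → ℝ) :
    IsClosed ({𝓥 : (j : ℕ) → GaugeField (F.P K) j (Matrix.specialUnitaryGroup (Fin 2) ℂ) |
        ∀ i, i < k → ∀ (c : PBond (F.P K) (i + 1)) (x : Idx (F.P K)), GaugeGroup.dist1 (loopHol (𝓥 i) c x) ≤ ℰp.δ / 2} ∩
      {𝓥 : (j : ℕ) → GaugeField (F.P K) j (Matrix.specialUnitaryGroup (Fin 2) ℂ) | ∀ j, j ≤ k → ∀ p : Plaq (F.P K) j,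
        (cornerSet j p ∩ lam42 (Omega 𝔠.lane.carrier.M₁ (rcolOf (T3Scales F γ hγ (hγ1.trans (sq_min_one_le _ 𝔠.gamma0_pos)) K) 𝔠.lane.carrier) k h) k j).Nonempty →
        (j < k → cornerSet j p ∩ Omega 𝔠.lane.carrier.M₁ (rcolOf (T3Scales F γ hγ (hγ1.trans (sq_min_one_le _ 𝔠.gamma0_pos)) K) 𝔠.lane.carrier) k h (j + 1) = ∅) →
        GaugeGroup.dist1 (GaugeField.plaqHol (datumAt (fun i => BlockAveraging.blockAvg (P := F.P K) (j := i) ℰp)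
          (lam42 (Omega 𝔠.lane.carrier.M₁ (rcolOf (T3Scales F γ hγ (hγ1.trans (sq_min_one_le _ 𝔠.gamma0_pos)) K) 𝔠.lane.carrier) k h) k) 𝓥 j) p) ≤ ε₁ j}) :=
  isClosed_smallLoopData_inter_reg7OnLe AlphaInputsT3AC.continuous_dist1_su2 ℰp smallContinuous_expMeanLogSU half_delta_lt k
    (fun j => Omega 𝔠.lane.carrier.M₁ (rcolOf (T3Scales F γ hγ (hγ1.trans (sq_min_one_le _ 𝔠.gamma0_pos)) K) 𝔠.lane.carrier) k h j)
    (lam42 (Omega 𝔠.lane.carrier.M₁ (rcolOf (T3Scales F γ hγ (hγ1.trans (sq_min_one_le _ 𝔠.gamma0_pos)) K) 𝔠.lane.carrier) k h) k) ε₁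

/-- **(D2) IS CLOSED**: «the frozen fields are recorded-large at the recorded plaquettes `p ∈ P_j(h)`: `eps1Of j ≤ |𝓥_j(∂p) − 1|`» (the ζ-clause of the masses, read on the data).
[cite: Balaban1985UV3, (40) p.266, (67) p.273] -/
theorem AlphaInputsT3AC.isClosed_recLargeData_T3 (k : ℕ) (h : Hist (F.P K) k) :
    IsClosed {𝓥 : (j : ℕ) → GaugeField (F.P K) j (Matrix.specialUnitaryGroup (Fin 2) ℂ) | ∀ (j : Fin k) (p : Plaq (F.P K) j), p ∈ h j →
      eps1Of (T3Scales F γ hγ (hγ1.trans (sq_min_one_le _ 𝔠.gamma0_pos)) K) 𝔠.lane.carrier j ≤ GaugeGroup.dist1 (GaugeField.plaqHol (𝓥 j) p)} := by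
  have hset : {𝓥 : (j : ℕ) → GaugeField (F.P K) j (Matrix.specialUnitaryGroup (Fin 2) ℂ) | ∀ (j : Fin k) (p : Plaq (F.P K) j), p ∈ h j →
      eps1Of (T3Scales F γ hγ (hγ1.trans (sq_min_one_le _ 𝔠.gamma0_pos)) K) 𝔠.lane.carrier j ≤ GaugeGroup.dist1 (GaugeField.plaqHol (𝓥 j) p)} =
      ⋂ (j : Fin k), ⋂ (p : Plaq (F.P K) j), {𝓥 | p ∈ h j →
        eps1Of (T3Scales F γ hγ (hγ1.trans (sq_min_one_le _ 𝔠.gamma0_pos)) K) 𝔠.lane.carrier j ≤ GaugeGroup.dist1 (GaugeField.plaqHol (𝓥 j) p)} := by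
    ext 𝓥
    simp only [mem_setOf_eq, mem_iInter]
  rw [hset]
  exact isClosed_iInter fun j => isClosed_iInter fun p => isClosed_setOf_imp
    (isClosed_le continuous_const ((AlphaInputsT3AC.continuous_dist1_su2.comp (continuous_plaqHol p)).comp (continuous_apply (j : ℕ))))

/-- **(D3) IS CLOSED**: «every frozen level `j ≤ k` is capped on the plaquettes inside `Ω_j(h)`: `|𝓥_j(∂p) − 1| ≤ κ j`» (the (40) window of the characteristic functions, read on
the data; any caps `κ : ℕ → ℝ`). [cite: Balaban1985UV3, (40) p.266] -/
theorem AlphaInputsT3AC.isClosed_cappedData_T3 (k : ℕ) (h : Hist (F.P K) k) (κ : ℕ → ℝ) :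
    IsClosed {𝓥 : (j : ℕ) → GaugeField (F.P K) j (Matrix.specialUnitaryGroup (Fin 2) ℂ) | ∀ j, j ≤ k → ∀ p : Plaq (F.P K) j,
      p ∈ plaqsIn j (Omega 𝔠.lane.carrier.M₁ (rcolOf (T3Scales F γ hγ (hγ1.trans (sq_min_one_le _ 𝔠.gamma0_pos)) K) 𝔠.lane.carrier) k h j) →
      GaugeGroup.dist1 (GaugeField.plaqHol (𝓥 j) p) ≤ κ j} := by
  have hset : {𝓥 : (j : ℕ) → GaugeField (F.P K) j (Matrix.specialUnitaryGroup (Fin 2) ℂ) | ∀ j, j ≤ k → ∀ p : Plaq (F.P K) j,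
      p ∈ plaqsIn j (Omega 𝔠.lane.carrier.M₁ (rcolOf (T3Scales F γ hγ (hγ1.trans (sq_min_one_le _ 𝔠.gamma0_pos)) K) 𝔠.lane.carrier) k h j) →
      GaugeGroup.dist1 (GaugeField.plaqHol (𝓥 j) p) ≤ κ j} =
      ⋂ (j : ℕ), ⋂ (_ : j ≤ k), ⋂ (p : Plaq (F.P K) j),
        {𝓥 | p ∈ plaqsIn j (Omega 𝔠.lane.carrier.M₁ (rcolOf (T3Scales F γ hγ (hγ1.trans (sq_min_one_le _ 𝔠.gamma0_pos)) K) 𝔠.lane.carrier) k h j) →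
          GaugeGroup.dist1 (GaugeField.plaqHol (𝓥 j) p) ≤ κ j} := by
    ext 𝓥
    simp only [mem_setOf_eq, mem_iInter]
  rw [hset]
  exact isClosed_iInter fun j => isClosed_iInter fun _ => isClosed_iInter fun p => isClosed_setOf_imp
    (isClosed_le ((AlphaInputsT3AC.continuous_dist1_su2.comp (continuous_plaqHol p)).comp (continuous_apply j)) continuous_const)

/-- ★ **(C1) THE JOINTLY (7)-REGULAR DATA SET `𝒟₇(k, h)` IS CLOSED** — multi-level `SU(2)` data `𝓥` with (D0) one-step `δ∕2`-small loops at the levels `< k`, (D1) print's (7)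
for the history `h` read with `≤` at level radii `ε₁` (cross-boundary datum included), (D2) recorded-large at `P_j(h)` — for ANY `ε₁ : ℕ → ℝ`: LITERALLY the three conjuncts of
LEAD FILE 2's `AlphaInputsT3AC.data7Set F 𝔠 γ hγ hγ1 K k h ε₁` (draft v2 a399c224063d2149, §1), so that `IsClosed (data7Set …)` is this theorem after `unfold`; the closed
admissible set `A` of ✓ `FrozenSelection.exists_frozenSelector`∕`exists_frozenEnvelope` for B1's measurable frozen selection `𝓥*`.  A capped variant adds
`isClosed_cappedData_T3` by `IsClosed.inter`. [cite: Balaban1985Variational, (3) + (7) p.278; Balaban1985UV3, (40) p.266, (67) p.273] -/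
theorem AlphaInputsT3AC.isClosed_data7 (k : ℕ) (h : Hist (F.P K) k) (ε₁ : ℕ → ℝ) :
    IsClosed {𝓥 : (j : ℕ) → GaugeField (F.P K) j (Matrix.specialUnitaryGroup (Fin 2) ℂ) |
      (∀ j, j < k → ∀ (c : PBond (F.P K) (j + 1)) (x : BlockAveraging.Idx (F.P K)),
        GaugeGroup.dist1 (BlockAveraging.loopHol (𝓥 j) c x) ≤ ℰp.δ / 2) ∧
      (∀ j, j ≤ k → ∀ p : Plaq (F.P K) j,
        (cornerSet j p ∩ lam42 (Omega 𝔠.lane.carrier.M₁ (rcolOf (T3Scales F γ hγ (hγ1.trans (sq_min_one_le _ 𝔠.gamma0_pos)) K) 𝔠.lane.carrier) k h) k j).Nonempty →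
        (j < k → cornerSet j p ∩ Omega 𝔠.lane.carrier.M₁ (rcolOf (T3Scales F γ hγ (hγ1.trans (sq_min_one_le _ 𝔠.gamma0_pos)) K) 𝔠.lane.carrier) k h (j + 1) = ∅) →
        GaugeGroup.dist1 (GaugeField.plaqHol
          (datumAt (fun i => BlockAveraging.blockAvg (P := F.P K) (j := i) ℰp)
            (lam42 (Omega 𝔠.lane.carrier.M₁ (rcolOf (T3Scales F γ hγ (hγ1.trans (sq_min_one_le _ 𝔠.gamma0_pos)) K) 𝔠.lane.carrier) k h) k) 𝓥 j) p) ≤ ε₁ j) ∧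
      (∀ (j : Fin k) (p : Plaq (F.P K) j), p ∈ h j →
        eps1Of (T3Scales F γ hγ (hγ1.trans (sq_min_one_le _ 𝔠.gamma0_pos)) K) 𝔠.lane.carrier j ≤ GaugeGroup.dist1 (GaugeField.plaqHol (𝓥 j) p))} := by
  rw [setOf_and, setOf_and, ← inter_assoc]
  exact (AlphaInputsT3AC.isClosed_smallLoopData_inter_reg7OnLe_T3 (𝔠 := 𝔠) (hγ := hγ) (hγ1 := hγ1) k h ε₁).inter
    (AlphaInputsT3AC.isClosed_recLargeData_T3 (𝔠 := 𝔠) (hγ := hγ) (hγ1 := hγ1) k h)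

/-- **THE COVARIANT DIVERGENCE AT SPACING `η` IS CONTINUOUS IN THE CONFIGURATION** (`covDivT η = η⁻¹ • covDivT 1`, ✓ `covDivT_eq_smul`, and ✓ `Prop8Criticality.continuous_covDivT`).
[cite: Balaban1985RegularSpaces, (1.1)–(1.2) p.76] -/
theorem AlphaInputsT3AC.continuous_covDivT_eta {P : Params} {j : ℕ} (η : ℝ) (μ : Fin P.d) (x : Site P j) :
    Continuous fun U : GaugeField P j (Matrix.specialUnitaryGroup (Fin 2) ℂ) => covDivT η (unitsField (toUField U)) μ x := by
  have heq : (fun U : GaugeField P j (Matrix.specialUnitaryGroup (Fin 2) ℂ) => covDivT η (unitsField (toUField U)) μ x) =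
      fun U => η⁻¹ • covDivT 1 (unitsField (toUField U)) μ x := funext fun U => covDivT_eq_smul η _ μ x
  rw [heq]
  exact (continuous_covDivT μ x).const_smul η⁻¹

/-- **BOTH CLAUSES OF (2), READ WITH `≤` OVER THE REGIONS OF `h`, FORM A CLOSED SET** (the closure of `RegOnT3 k h e`): for every `j ≤ k`, `|U(∂q) − 1| ≤ e·L^{−2j}` at the fine
plaquettes touching `Ω_j(h)` and `‖(D^{η*}_U ∂U)(b)‖ ≤ e·L^{−2j}·(Lʲη)⁻¹` at the fine bonds touching `Ω_j(h)`, `η = L^{−k}` — finitely many `≤`-conditions on continuous maps.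
[cite: Balaban1985Variational, (2) p.278; Balaban1985RegularSpaces, (1.7), (1.9) p.77] -/
theorem AlphaInputsT3AC.isClosed_regOnT3Le (k : ℕ) (h : Hist (F.P K) k) (e : ℝ) :
    IsClosed {U : GaugeField (F.P K) 0 (Matrix.specialUnitaryGroup (Fin 2) ℂ) | ∀ j, j ≤ k →
      (∀ q : Plaq (F.P K) 0, Touches (Omega 𝔠.lane.carrier.M₁ (rcolOf (T3Scales F γ hγ (hγ1.trans (sq_min_one_le _ 𝔠.gamma0_pos)) K) 𝔠.lane.carrier) k h j) q →
        GaugeGroup.dist1 (GaugeField.plaqHol U q) ≤ e * ((((F.P K).L : ℝ) ^ j)⁻¹) ^ 2) ∧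
      (∀ b : PBond (F.P K) 0, BTouches (Omega 𝔠.lane.carrier.M₁ (rcolOf (T3Scales F γ hγ (hγ1.trans (sq_min_one_le _ 𝔠.gamma0_pos)) K) 𝔠.lane.carrier) k h j) b →
        ‖covDivT ((((F.P K).L : ℝ))⁻¹ ^ k) (unitsField (toUField U)) b.dir b.src‖ ≤
          e * ((((F.P K).L : ℝ) ^ j)⁻¹) ^ 2 * ((((F.P K).L : ℝ) ^ j) * ((((F.P K).L : ℝ))⁻¹ ^ k))⁻¹)} := by
  have hset : {U : GaugeField (F.P K) 0 (Matrix.specialUnitaryGroup (Fin 2) ℂ) | ∀ j, j ≤ k →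
      (∀ q : Plaq (F.P K) 0, Touches (Omega 𝔠.lane.carrier.M₁ (rcolOf (T3Scales F γ hγ (hγ1.trans (sq_min_one_le _ 𝔠.gamma0_pos)) K) 𝔠.lane.carrier) k h j) q →
        GaugeGroup.dist1 (GaugeField.plaqHol U q) ≤ e * ((((F.P K).L : ℝ) ^ j)⁻¹) ^ 2) ∧
      (∀ b : PBond (F.P K) 0, BTouches (Omega 𝔠.lane.carrier.M₁ (rcolOf (T3Scales F γ hγ (hγ1.trans (sq_min_one_le _ 𝔠.gamma0_pos)) K) 𝔠.lane.carrier) k h j) b →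
        ‖covDivT ((((F.P K).L : ℝ))⁻¹ ^ k) (unitsField (toUField U)) b.dir b.src‖ ≤
          e * ((((F.P K).L : ℝ) ^ j)⁻¹) ^ 2 * ((((F.P K).L : ℝ) ^ j) * ((((F.P K).L : ℝ))⁻¹ ^ k))⁻¹)} =
      ⋂ (j : ℕ), ⋂ (_ : j ≤ k),
        ((⋂ (q : Plaq (F.P K) 0), {U | Touches (Omega 𝔠.lane.carrier.M₁ (rcolOf (T3Scales F γ hγ (hγ1.trans (sq_min_one_le _ 𝔠.gamma0_pos)) K) 𝔠.lane.carrier) k h j) q →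
          GaugeGroup.dist1 (GaugeField.plaqHol U q) ≤ e * ((((F.P K).L : ℝ) ^ j)⁻¹) ^ 2}) ∩
        (⋂ (b : PBond (F.P K) 0), {U | BTouches (Omega 𝔠.lane.carrier.M₁ (rcolOf (T3Scales F γ hγ (hγ1.trans (sq_min_one_le _ 𝔠.gamma0_pos)) K) 𝔠.lane.carrier) k h j) b →
          ‖covDivT ((((F.P K).L : ℝ))⁻¹ ^ k) (unitsField (toUField U)) b.dir b.src‖ ≤
            e * ((((F.P K).L : ℝ) ^ j)⁻¹) ^ 2 * ((((F.P K).L : ℝ) ^ j) * ((((F.P K).L : ℝ))⁻¹ ^ k))⁻¹})) := by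
    ext U
    simp only [mem_setOf_eq, mem_iInter, mem_inter_iff]
  rw [hset]
  exact isClosed_iInter fun j => isClosed_iInter fun _ =>
    (isClosed_iInter fun q => isClosed_setOf_imp
      (isClosed_le (AlphaInputsT3AC.continuous_dist1_su2.comp (continuous_plaqHol q)) continuous_const)).inter
    (isClosed_iInter fun b => isClosed_setOf_imp
      (isClosed_le (AlphaInputsT3AC.continuous_covDivT_eta _ b.dir b.src).norm continuous_const))

/-- ★ **(C2) THE REGIONAL REGULAR FIBRE (8), READ WITH `≤`, IS CLOSED ON THE LOCAL SMALL-LOOP CORE**: for ANY exactly dependency-closed bond family `E` containing the bonds the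
constraint (3) of the history `h` reads (`bondsOn j (Λ_j(h)) ⊆ E j`, `j ≤ k ≤ K`), the set «`U ∈ NestedSmallOn ℰp (δ∕2) E k` ∧ (2) with `≤` over the `Ω_j(h)` (BOTH clauses) ∧
(3) `ConstraintOn (blockAvg ℰp) k Λ(h) 𝓥 U`» is CLOSED — the closed class `C` of ✓ `exists_measurable_argmin_closedClass` for B1's measurable minimiser.
[cite: Balaban1985Variational, (2)–(3), (6) p.278, (8) p.279] -/
theorem AlphaInputsT3AC.isClosed_coreFibreRegLe {k : ℕ} (hk : k ≤ K) (h : Hist (F.P K) k) {E : (i : ℕ) → Set (PBond (F.P K) i)}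
    (hE : DepClosed₂ E)
    (hread : ∀ j, j ≤ k → bondsOn j (lam42 (Omega 𝔠.lane.carrier.M₁
      (rcolOf (T3Scales F γ hγ (hγ1.trans (sq_min_one_le _ 𝔠.gamma0_pos)) K) 𝔠.lane.carrier) k h) k j) ⊆ E j)
    (e : ℝ) (𝓥 : (j : ℕ) → GaugeField (F.P K) j (Matrix.specialUnitaryGroup (Fin 2) ℂ)) :
    IsClosed (NestedSmallOn ℰp (ℰp.δ / 2) E k ∩
      {U : GaugeField (F.P K) 0 (Matrix.specialUnitaryGroup (Fin 2) ℂ) | ∀ j, j ≤ k →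
        (∀ q : Plaq (F.P K) 0, Touches (Omega 𝔠.lane.carrier.M₁ (rcolOf (T3Scales F γ hγ (hγ1.trans (sq_min_one_le _ 𝔠.gamma0_pos)) K) 𝔠.lane.carrier) k h j) q →
          GaugeGroup.dist1 (GaugeField.plaqHol U q) ≤ e * ((((F.P K).L : ℝ) ^ j)⁻¹) ^ 2) ∧
        (∀ b : PBond (F.P K) 0, BTouches (Omega 𝔠.lane.carrier.M₁ (rcolOf (T3Scales F γ hγ (hγ1.trans (sq_min_one_le _ 𝔠.gamma0_pos)) K) 𝔠.lane.carrier) k h j) b →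
          ‖covDivT ((((F.P K).L : ℝ))⁻¹ ^ k) (unitsField (toUField U)) b.dir b.src‖ ≤
            e * ((((F.P K).L : ℝ) ^ j)⁻¹) ^ 2 * ((((F.P K).L : ℝ) ^ j) * ((((F.P K).L : ℝ))⁻¹ ^ k))⁻¹)} ∩
      {U : GaugeField (F.P K) 0 (Matrix.specialUnitaryGroup (Fin 2) ℂ) |
        ConstraintOn (fun i => BlockAveraging.blockAvg (P := F.P K) (j := i) ℰp) k
          (lam42 (Omega 𝔠.lane.carrier.M₁ (rcolOf (T3Scales F γ hγ (hγ1.trans (sq_min_one_le _ 𝔠.gamma0_pos)) K) 𝔠.lane.carrier) k h) k) 𝓥 U}) := by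
  have hC := isClosed_nestedSmallOn_inter_constraintOn AlphaInputsT3AC.continuous_dist1_su2 ℰp smallContinuous_expMeanLogSU half_delta_lt hE
    (AlphaInputsT3AC.le_standing_of_le hk)
    (lam42 (Omega 𝔠.lane.carrier.M₁ (rcolOf (T3Scales F γ hγ (hγ1.trans (sq_min_one_le _ 𝔠.gamma0_pos)) K) 𝔠.lane.carrier) k h) k) hread 𝓥
  have hR := AlphaInputsT3AC.isClosed_regOnT3Le (𝔠 := 𝔠) (hγ := hγ) (hγ1 := hγ1) k h e
  rw [inter_comm (NestedSmallOn _ _ _ _), inter_assoc]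
  exact hR.inter hC

/-- ★ **(C3) ON THE T³ CARRIER: THE NORMALISED DATUM MAP IS CONTINUOUS ON THE LOCAL SMALL-LOOP CORE** (`k ≤ K`; any exactly dependency-closed `E` containing the read bonds of (3)).
[cite: Balaban1985UV3, (42) p.266; Balaban1987RG1, (0.4) p.253] -/
theorem AlphaInputsT3AC.continuousOn_datumE_T3 {k : ℕ} (hk : k ≤ K) (h : Hist (F.P K) k) {E : (i : ℕ) → Set (PBond (F.P K) i)}
    (hE : DepClosed₂ E)
    (hread : ∀ j, j ≤ k → bondsOn j (lam42 (Omega 𝔠.lane.carrier.M₁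
      (rcolOf (T3Scales F γ hγ (hγ1.trans (sq_min_one_le _ 𝔠.gamma0_pos)) K) 𝔠.lane.carrier) k h) k j) ⊆ E j) :
    ContinuousOn (fun U : GaugeField (F.P K) 0 (Matrix.specialUnitaryGroup (Fin 2) ℂ) =>
      datumE (fun i => BlockAveraging.blockAvg (P := F.P K) (j := i) ℰp) k
        (lam42 (Omega 𝔠.lane.carrier.M₁ (rcolOf (T3Scales F γ hγ (hγ1.trans (sq_min_one_le _ 𝔠.gamma0_pos)) K) 𝔠.lane.carrier) k h) k) U)
      (NestedSmallOn ℰp (ℰp.δ / 2) E k) :=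
  continuousOn_datumE AlphaInputsT3AC.continuous_dist1_su2 ℰp smallContinuous_expMeanLogSU half_delta_lt hE (AlphaInputsT3AC.le_standing_of_le hk)
    (lam42 (Omega 𝔠.lane.carrier.M₁ (rcolOf (T3Scales F γ hγ (hγ1.trans (sq_min_one_le _ 𝔠.gamma0_pos)) K) 𝔠.lane.carrier) k h) k) hread

/-! ### The exact dependency cone of the bonds the constraint reads -/

/-- **THE CONSTRAINT'S READ CONE IS EXACTLY DEPENDENCY-CLOSED** (`k ≤ K`): the level-`s` bonds whose both endpoints lie, at some scale `i` with `s ≤ i ≤ k`, in the `i`-blocks of the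
endpoints of ONE bond `c` lying on `Λ_i(h)` — the exact dependency hull of `⋃_{i ≤ k} bondsOn i (Λ_i(h))`, written inline — form a `DepClosed₂` family: a bond exactly feeding a
member has its endpoint blocks among the member's endpoints, and coarsening factors through every intermediate scale (✓ `coarsen_eq_of_coarsen_eq`).
[cite: Balaban1985Averaging, p.24; Balaban1985Variational, (3) p.278] -/
theorem AlphaInputsT3AC.depClosed₂_constraintCone {k : ℕ} (hk : k ≤ K) (h : Hist (F.P K) k) :
    DepClosed₂ (fun s => {b : PBond (F.P K) s | ∃ i, s ≤ i ∧ i ≤ k ∧ ∃ c : PBond (F.P K) i,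
      c ∈ bondsOn i (lam42 (Omega 𝔠.lane.carrier.M₁ (rcolOf (T3Scales F γ hγ (hγ1.trans (sq_min_one_le _ 𝔠.gamma0_pos)) K) 𝔠.lane.carrier) k h) k i) ∧
      (coarsen i (toFine s b.src) = c.src ∨ coarsen i (toFine s b.src) = c.tgt) ∧
      (coarsen i (toFine s b.tgt) = c.src ∨ coarsen i (toFine s b.tgt) = c.tgt)}) := by
  intro s c' hc' b hb
  obtain ⟨i, hsi, hik, c, hc, hsrc', htgt'⟩ := hc'
  have hs1 : s + 1 ≤ (F.P K).m + (F.P K).K := (hsi.trans hik).trans (AlphaInputsT3AC.le_standing_of_le hk)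
  have hs0 : s ≤ (F.P K).m + (F.P K).K := (Nat.le_succ s).trans hs1
  -- coarsening to scale `i ≥ s+1` factors through the `(s+1)`-block
  have key : ∀ (z : Site (F.P K) s) (y : Site (F.P K) (s + 1)), blockOf z = y →
      coarsen i (toFine s z) = coarsen i (toFine (s + 1) y) := by
    intro z y hzy
    refine coarsen_eq_of_coarsen_eq (j' := s + 1) ?_ hsi
    rw [coarsen_succ, coarsen_toFine s hs0, hzy, coarsen_toFine (s + 1) hs1]
  have hend : ∀ (z : Site (F.P K) s), (blockOf z = c'.src ∨ blockOf z = c'.tgt) →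
      coarsen i (toFine s z) = c.src ∨ coarsen i (toFine s z) = c.tgt := by
    intro z hz
    rcases hz with hz | hz
    · rw [key z c'.src hz]; exact hsrc'
    · rw [key z c'.tgt hz]; exact htgt'
  exact ⟨i, (Nat.le_succ s).trans hsi, hik, c, hc, hend b.src hb.1, hend b.tgt hb.2⟩

/-- **THE BONDS (3) READS LIE IN THEIR CONE**: `bondsOn i (Λ_i(h)) ⊆ cone i` for every `i ≤ k` (take `c := b`). [cite: Balaban1985Variational, (3) p.278] -/
theorem AlphaInputsT3AC.bondsOn_subset_constraintCone {k : ℕ} (hk : k ≤ K) (h : Hist (F.P K) k) {i : ℕ} (hi : i ≤ k) :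
    bondsOn i (lam42 (Omega 𝔠.lane.carrier.M₁ (rcolOf (T3Scales F γ hγ (hγ1.trans (sq_min_one_le _ 𝔠.gamma0_pos)) K) 𝔠.lane.carrier) k h) k i) ⊆
      {b : PBond (F.P K) i | ∃ i', i ≤ i' ∧ i' ≤ k ∧ ∃ c : PBond (F.P K) i',
        c ∈ bondsOn i' (lam42 (Omega 𝔠.lane.carrier.M₁ (rcolOf (T3Scales F γ hγ (hγ1.trans (sq_min_one_le _ 𝔠.gamma0_pos)) K) 𝔠.lane.carrier) k h) k i') ∧
        (coarsen i' (toFine i b.src) = c.src ∨ coarsen i' (toFine i b.src) = c.tgt) ∧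
        (coarsen i' (toFine i b.tgt) = c.src ∨ coarsen i' (toFine i b.tgt) = c.tgt)} := by
  intro b hb
  have hi' : i ≤ (F.P K).m + (F.P K).K := hi.trans (AlphaInputsT3AC.le_standing_of_le hk)
  refine ⟨i, le_rfl, hi, b, hb, Or.inl ?_, Or.inr ?_⟩
  · exact coarsen_toFine i hi' b.src
  · exact coarsen_toFine i hi' b.tgt

/-- **(C2) AT THE CONE**: the regular fibre (8) of the history `h` read with `≤` is closed on the small-loop core of the constraint's own read cone.
[cite: Balaban1985Variational, (2)–(3), (6) p.278, (8) p.279] -/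
theorem AlphaInputsT3AC.isClosed_coneFibreRegLe {k : ℕ} (hk : k ≤ K) (h : Hist (F.P K) k) (e : ℝ)
    (𝓥 : (j : ℕ) → GaugeField (F.P K) j (Matrix.specialUnitaryGroup (Fin 2) ℂ)) :
    IsClosed (NestedSmallOn ℰp (ℰp.δ / 2) (fun s => {b : PBond (F.P K) s | ∃ i, s ≤ i ∧ i ≤ k ∧ ∃ c : PBond (F.P K) i,
        c ∈ bondsOn i (lam42 (Omega 𝔠.lane.carrier.M₁ (rcolOf (T3Scales F γ hγ (hγ1.trans (sq_min_one_le _ 𝔠.gamma0_pos)) K) 𝔠.lane.carrier) k h) k i) ∧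
        (coarsen i (toFine s b.src) = c.src ∨ coarsen i (toFine s b.src) = c.tgt) ∧
        (coarsen i (toFine s b.tgt) = c.src ∨ coarsen i (toFine s b.tgt) = c.tgt)}) k ∩
      {U : GaugeField (F.P K) 0 (Matrix.specialUnitaryGroup (Fin 2) ℂ) | ∀ j, j ≤ k →
        (∀ q : Plaq (F.P K) 0, Touches (Omega 𝔠.lane.carrier.M₁ (rcolOf (T3Scales F γ hγ (hγ1.trans (sq_min_one_le _ 𝔠.gamma0_pos)) K) 𝔠.lane.carrier) k h j) q →
          GaugeGroup.dist1 (GaugeField.plaqHol U q) ≤ e * ((((F.P K).L : ℝ) ^ j)⁻¹) ^ 2) ∧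
        (∀ b : PBond (F.P K) 0, BTouches (Omega 𝔠.lane.carrier.M₁ (rcolOf (T3Scales F γ hγ (hγ1.trans (sq_min_one_le _ 𝔠.gamma0_pos)) K) 𝔠.lane.carrier) k h j) b →
          ‖covDivT ((((F.P K).L : ℝ))⁻¹ ^ k) (unitsField (toUField U)) b.dir b.src‖ ≤
            e * ((((F.P K).L : ℝ) ^ j)⁻¹) ^ 2 * ((((F.P K).L : ℝ) ^ j) * ((((F.P K).L : ℝ))⁻¹ ^ k))⁻¹)} ∩
      {U : GaugeField (F.P K) 0 (Matrix.specialUnitaryGroup (Fin 2) ℂ) |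
        ConstraintOn (fun i => BlockAveraging.blockAvg (P := F.P K) (j := i) ℰp) k
          (lam42 (Omega 𝔠.lane.carrier.M₁ (rcolOf (T3Scales F γ hγ (hγ1.trans (sq_min_one_le _ 𝔠.gamma0_pos)) K) 𝔠.lane.carrier) k h) k) 𝓥 U}) :=
  AlphaInputsT3AC.isClosed_coreFibreRegLe (𝔠 := 𝔠) (hγ := hγ) (hγ1 := hγ1) hk h
    (AlphaInputsT3AC.depClosed₂_constraintCone (𝔠 := 𝔠) (hγ := hγ) (hγ1 := hγ1) hk h)
    (fun _ hj => AlphaInputsT3AC.bondsOn_subset_constraintCone (𝔠 := 𝔠) (hγ := hγ) (hγ1 := hγ1) hk h hj) e 𝓥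

/-- **(C3) AT THE CONE**: the normalised datum map of the history `h` is continuous on the small-loop core of the constraint's own read cone.
[cite: Balaban1985UV3, (42) p.266; Balaban1987RG1, (0.4) p.253] -/
theorem AlphaInputsT3AC.continuousOn_datumE_cone {k : ℕ} (hk : k ≤ K) (h : Hist (F.P K) k) :
    ContinuousOn (fun U : GaugeField (F.P K) 0 (Matrix.specialUnitaryGroup (Fin 2) ℂ) =>
      datumE (fun i => BlockAveraging.blockAvg (P := F.P K) (j := i) ℰp) k
        (lam42 (Omega 𝔠.lane.carrier.M₁ (rcolOf (T3Scales F γ hγ (hγ1.trans (sq_min_one_le _ 𝔠.gamma0_pos)) K) 𝔠.lane.carrier) k h) k) U)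
      (NestedSmallOn ℰp (ℰp.δ / 2) (fun s => {b : PBond (F.P K) s | ∃ i, s ≤ i ∧ i ≤ k ∧ ∃ c : PBond (F.P K) i,
        c ∈ bondsOn i (lam42 (Omega 𝔠.lane.carrier.M₁ (rcolOf (T3Scales F γ hγ (hγ1.trans (sq_min_one_le _ 𝔠.gamma0_pos)) K) 𝔠.lane.carrier) k h) k i) ∧
        (coarsen i (toFine s b.src) = c.src ∨ coarsen i (toFine s b.src) = c.tgt) ∧
        (coarsen i (toFine s b.tgt) = c.src ∨ coarsen i (toFine s b.tgt) = c.tgt)}) k) :=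
  AlphaInputsT3AC.continuousOn_datumE_T3 (𝔠 := 𝔠) (hγ := hγ) (hγ1 := hγ1) hk h
    (AlphaInputsT3AC.depClosed₂_constraintCone (𝔠 := 𝔠) (hγ := hγ) (hγ1 := hγ1) hk h)
    fun _ hj => AlphaInputsT3AC.bondsOn_subset_constraintCone (𝔠 := 𝔠) (hγ := hγ) (hγ1 := hγ1) hk h hj

end T3

end Summit.QuantumFields.YangMills.Theorems

end
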